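import Summits.QuantumFields.YangMills.Theorems.AlphaInputsT3ACv2RecWindow
import HarnessLib

/-!
# `AlphaInputsT3ACv2RecWindowIneq` — (41′) a.e. AND INTEGRABILITY FOR THE WINDOWED DATUM `OfV2At.dataT3cW`, every `j ≤ K`, and the bundle in the
# quantifier order of line v5p3's STUB 2‴ (crux `HistoryTailL` = stmt-QuantumFields-19936; sequel of `AlphaInputsT3ACv2RecWindow`)

Lane `pub-balaban3d`, seat alpha-1 (g3).  (41′) at a positive level `k + 1 ≤ K` is the windowed step `WindowStep.ineq41_windowed_succ_ae` (prequel §0) fed with the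
package's (41)_k (`PkgAt.ineq41_47`), its step rows at `k` (`hU`/`hPm`/`hPb` through `Bound55AC.hint_stdAC`, the residual `Fibre49AC`, the nine
leaves `Thm2AC.stepResidualsAC_of_alpha` for the exponent bookkeeping), [Balaban1985Averaging] Prop. 1 for the window (`blockAvg_mem_windowT3`,
`ε₁(k) = θBal(K − k)` by `PkgAt.eps1_eq`) and `resDensity = e^{E}·ρ_{k+1}` a.e. (`PkgAt.resDensity_ae_eq`); at level `0` the windowed majorant IS
the lane's ((1) p.256: one history, weight `1`).  Integrability of `up_{dataT3cW}`: each summand is an integrable density times `exp` of a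
measurable exponent bounded above, given the data rows at the level (step rows below the top, terminal rows at the top).  The bundle
`windowedTrivialWeight_v2` is STUB 2‴ with its three located corrections (support from `j = 1`, `∫ ≤ max j 1`, no non-trivial support clause —
seat findings F-α1-9/10/11, module docstring of the prequel).  CONDITIONAL on the package; nothing of [Balaban1985UV3] asserted.

References: T. Bałaban, Commun. Math. Phys. 102 (1985) 255–275 [Balaban1985UV3] ((1) p.256, (40)–(41) p.266, (47) p.267, Thm 2 p.272);
Commun. Math. Phys. 98 (1985) 17–51 [Balaban1985Averaging] (Prop. 1 (51) p.26).
-/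

set_option autoImplicit false

noncomputable section

namespace Summit.QuantumFields.YangMills.Theorems

open MeasureTheory
open Literature.MathematicalPhysics.QuantumFieldTheory.Balaban1983to89
open Literature.MathematicalPhysics.QuantumFieldTheory.Balaban1983to89.T3ContinuumYM3Torus
open Literature.MathematicalPhysics.QuantumFieldTheory.Balaban1983to89.T3UnitLawDensityEML (ℰp)
open Literature.MathematicalPhysics.QuantumFieldTheory.Balaban1983to89.T3UnitScaleTilt (θBal)
open Literature.MathematicalPhysics.QuantumFieldTheory.Balaban1983to89.T3RestrictedUnitDensity (resDensity)
open Literature.MathematicalPhysics.QuantumFieldTheory.Balaban1983to89.T3AlphaInputsAC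
open Literature.MathematicalPhysics.QuantumFieldTheory.Balaban1985CMP102
open Literature.MathematicalPhysics.QuantumFieldTheory.Balaban1985CMP102.Setting
open Summit.QuantumFields.Balaban3D.Carriers
open Summit.QuantumFields.Balaban3D.Proofs.Primitives
open Summit.QuantumFields.Balaban3D.Proofs.TowerAC
open Summit.QuantumFields.Balaban3D.Proofs.StandardAC
open Summit.QuantumFields.Balaban3D.Proofs.InputsAC
open Summit.QuantumFields.Balaban3D.Proofs.MassesAC
open Summit.QuantumFields.Balaban3D.Proofs.TrivMassAC
open Summit.QuantumFields.Balaban3D.Proofs.WindowAC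
open Summit.QuantumFields.Balaban3D.Proofs.Thm2AC (stepResidualsAC_of_alpha)
open Summit.QuantumFields.Balaban3D.Proofs.Bound55AC (hint_stdAC)
open Summit.QuantumFields.Balaban3D.Proofs.TransportAC (integrable_mul_exp_of_le)
open Summit.QuantumFields.Balaban3D.Proofs (Bound55Std.measurable_actionEta Bound55Std.actionEta_nonneg)

open Classical

variable {F : T3Family} {𝔠 : AlphaConsts F.L (suGroupModel 2).N} {a₀ a₁ : ℝ}

/-! ## §1 (41′) a.e. for the windowed datum -/

section Ineq

variable (h : AlphaInputsT3AC.OfV2At F 𝔠 a₀ a₁) (hc : 0 < a₀ ∧ 0 < a₁ ∧ 𝔠.B₃ * a₁ ≤ a₀) (γ : ℝ) (hγ : 0 < γ)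
  (hγ1 : γ ≤ (min 𝔠.gamma0 1) ^ 2) (π : AlphaInputsT3AC.PolymerT3 F)

/-- `e^{−a+b−c+d+r} = e^{−c+r}·e^{−a+b+d}` (the (41) exponent with its constants pulled out). [folklore] -/
private theorem exp_split (a b c d r : ℝ) : Real.exp (-a + b - c + d + r) = Real.exp (-c + r) * Real.exp (-a + b + d) := by
  rw [← Real.exp_add]; congr 1; ring

/-- **(41′) `dV`-A.E. FOR THE WINDOWED DATUM AT A POSITIVE LEVEL `k + 1 ≤ K`** (for `γ ≤ γw`): the windowed step `WindowStep.ineq41_windowed_succ_ae` fed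
with the package's (41)_k (`PkgAt.ineq41_47`), its step rows at `k` (`hU`/`hPm`/`hPb` for `hint`, the residual `Fibre49AC`, the nine leaves
`Thm2AC.stepResidualsAC_of_alpha`), [Balaban1985Averaging] Prop. 1 for the window (`blockAvg_mem_windowT3`, `ε₁(k) = θBal(K − k)`), and
`resDensity = e^{E}·ρ_{k+1}` a.e. (`PkgAt.resDensity_ae_eq`). [cite: Balaban1985UV3, (41) p.266 and Thm 2 p.272] -/
theorem AlphaInputsT3AC.OfV2At.dataT3cW_ineq41AE_succ (hγw : γ ≤ AlphaInputsT3AC.γwOf F.L 𝔠.b₀ 𝔠.p₀) (K k : ℕ) (hk : k + 1 ≤ K) :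
    Ineq41AE (h.dataT3cW hc γ hγ hγ1 π) K (k + 1) := by
  have hγ1' : γ ≤ 1 := hγ1.trans (sq_min_one_le _ 𝔠.gamma0_pos)
  have A := (h.pkgAtV2 hc γ hγ hγ1 K).run.steps k hk
  have he : eps1Of (T3Scales F γ hγ hγ1' K) 𝔠.lane.carrier k = θBal F.L γ 𝔠.b₀ 𝔠.p₀ (K - k) :=
    (h.pkgAtV2 hc γ hγ hγ1 K).toPkgAt.eps1_eq k (by omega)
  have hsmall : ∀ U : GaugeField (F.P K) k (Matrix.specialUnitaryGroup (Fin 2) ℂ),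
      PlaqSmall (eps1Of (T3Scales F γ hγ hγ1' K) 𝔠.lane.carrier k) U →
        ((h.pkgAtV2 hc γ hγ hγ1 K).X.av k).avg U ∈ AlphaInputsT3AC.windowT3 F 𝔠 γ K k := by
    intro U hU
    rw [he] at hU
    show (avT3 F K k).avg U ∈ _
    rw [avT3_of_le F K (by omega : k + 1 ≤ F.m + K)]
    exact AlphaInputsT3AC.blockAvg_mem_windowT3 F 𝔠 hγ hγ1' hγw K k (by omega) U hU
  have hstep := WindowStep.ineq41_windowed_succ_ae 𝔠.lane (h.pkgAtV2 hc γ hγ hγ1 K).X (h.pkgAtV2 hc γ hγ hγ1 K).𝔖 k hk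
    ((h.pkgAtV2 hc γ hγ hγ1 K).toPkgAt.ineq41_47 k (by omega)).1
    (stepResidualsAC_of_alpha (T3Scales_window F 𝔠 γ hγ hγ1 K) k hk A)
    (hint_stdAC (h.pkgAtV2 hc γ hγ hγ1 K).X 𝔠.lane.carrier (h.pkgAtV2 hc γ hγ hγ1 K).𝔖 (fun _ => True) k
      A.hU A.hPm ((h.pkgAtV2 hc γ hγ hγ1 K).𝔄.cP k) A.hPb)
    A.fibre49 (AlphaInputsT3AC.windowT3 F 𝔠 γ K k) (AlphaInputsT3AC.measurableSet_windowT3 F 𝔠 γ K k) hsmall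
  have hres := (h.pkgAtV2 hc γ hγ hγ1 K).toPkgAt.resDensity_ae_eq (k + 1) (by omega)
  have hE : Real.exp (-((h.dataT3cW hc γ hγ hγ1 π).Ecst K (k + 1)) + (h.dataT3cW hc γ hγ hγ1 π).Rm K (k + 1)) =
      Real.exp (h.pkgAtV2 hc γ hγ hγ1 K).E *
        Real.exp (-((h.pkgAtV2 hc γ hγ hγ1 K).T.Ecst (k + 1)) + (h.pkgAtV2 hc γ hγ hγ1 K).T.Rm (k + 1)) := by
    rw [← Real.exp_add]
    congr 1
    show -((h.pkgAtV2 hc γ hγ hγ1 K).T.Ecst (k + 1) - (h.pkgAtV2 hc γ hγ hγ1 K).E) + (h.pkgAtV2 hc γ hγ hγ1 K).T.Rm (k + 1) = _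
    ring
  unfold Ineq41AE
  filter_upwards [hstep, hres] with W hW hR
  rw [hR, hE, mul_assoc]
  refine mul_le_mul_of_nonneg_left ?_ (Real.exp_pos _).le
  simp only [exp_split] at hW
  refine hW.trans (le_of_eq ?_)
  rw [h.dataT3cW_up_eq hc γ hγ hγ1 π, mul_add, Finset.mul_sum]
  congr 1
  · rw [mul_left_comm]
    rfl
  · exact Finset.sum_congr rfl fun r _ => by rw [mul_left_comm]

/-- **(41′) AT LEVEL `0`**: no window ((1) p.256) — the windowed datum's majorant IS the lane's at `j = 0` (`wtW K 0 = 1 = m_0`, one history).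
[cite: Balaban1985UV3, (1) p.256] -/
theorem AlphaInputsT3AC.OfV2At.dataT3cW_ineq41AE_zero (K : ℕ) : Ineq41AE (h.dataT3cW hc γ hγ hγ1 π) K 0 := by
  have h0 := h.dataT3c_ineq41AE hc γ hγ hγ1 π K 0 (Nat.zero_le K)
  have hup : ∀ W : GaugeField (F.P K) 0 (Matrix.specialUnitaryGroup (Fin 2) ℂ),
      (h.dataT3cW hc γ hγ hγ1 π).up K 0 W = (h.dataT3c hc γ hγ hγ1 π).up K 0 W := by
    intro W
    rw [h.dataT3cW_up_eq hc γ hγ hγ1 π, h.dataT3c_up_eq_sum hc γ hγ hγ1 π,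
      Finset.sum_eq_zero (fun r hr => absurd (Hist.eq_triv_zero r) (Finset.ne_of_mem_erase hr)), add_zero,
      Fintype.sum_unique, (inputOfAC 𝔠.lane (h.pkgAtV2 hc γ hγ hγ1 K).X (h.pkgAtV2 hc γ hγ hγ1 K).𝔖).W.mass_zero, one_mul,
      show (default : Hist (F.P K) 0) = Hist.triv (F.P K) 0 from Hist.eq_triv_zero _]
    show trivWt _ _ _ _ _ _ 0 W * _ = _
    rw [trivWt_zero, one_mul]
  unfold Ineq41AE
  filter_upwards [h0] with W hW
  rw [hup W]
  exact hW

/-- **(41′) `dV`-a.e. FOR THE WINDOWED DATUM, EVERY `j ≤ K`** (for `γ ≤ γw`). [cite: Balaban1985UV3, (41) p.266 and Thm 2 p.272] -/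
theorem AlphaInputsT3AC.OfV2At.dataT3cW_ineq41AE (hγw : γ ≤ AlphaInputsT3AC.γwOf F.L 𝔠.b₀ 𝔠.p₀) (K j : ℕ) (hj : j ≤ K) :
    Ineq41AE (h.dataT3cW hc γ hγ hγ1 π) K j := by
  rcases j with _ | k
  · exact h.dataT3cW_ineq41AE_zero hc γ hγ hγ1 π K
  · exact h.dataT3cW_ineq41AE_succ hc γ hγ hγ1 π hγw K k hj

/-- **THE WINDOWED MAJORANT IS INTEGRABLE GIVEN THE DATA ROWS AT LEVEL `j`** (`U_j(·,h)` measurable, `Pint_j(h,·)` measurable and bounded above):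
each summand `m·e^{Φ′}` resp. `wtW·e^{Φ′}` is an integrable density times `exp` of a measurable exponent bounded above
(`TransportAC.integrable_mul_exp_of_le`). [cite: Balaban1985UV3, (41) p.266] -/
theorem AlphaInputsT3AC.OfV2At.integrable_upW_of_rows (K j : ℕ)
    (hU : ∀ hh : Hist (F.P K) j, Measurable ((h.pkgAtV2 hc γ hγ hγ1 K).UkH j hh))
    (hPm : ∀ hh : Hist (F.P K) j, Measurable ((inputOfAC 𝔠.lane (h.pkgAtV2 hc γ hγ hγ1 K).X (h.pkgAtV2 hc γ hγ hγ1 K).𝔖).Pint j hh)) (cP : ℝ)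
    (hPb : ∀ (hh : Hist (F.P K) j) (U : GaugeField (F.P K) j (Matrix.specialUnitaryGroup (Fin 2) ℂ)),
      (inputOfAC 𝔠.lane (h.pkgAtV2 hc γ hγ hγ1 K).X (h.pkgAtV2 hc γ hγ hγ1 K).𝔖).Pint j hh U ≤ cP) :
    Integrable ((h.dataT3cW hc γ hγ hγ1 π).up K j) (fieldMeasure (F.P K) j (Matrix.specialUnitaryGroup (Fin 2) ℂ)) := by
  have hmain : ∀ (hh : Hist (F.P K) j) (W : GaugeField (F.P K) j (Matrix.specialUnitaryGroup (Fin 2) ℂ)), (h.pkgAtV2 hc γ hγ hγ1 K).T.mainT j hh W =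
      ((T3Scales F γ hγ (hγ1.trans (sq_min_one_le _ 𝔠.gamma0_pos)) K).gk j)⁻¹ ^ 2 *
        (T3Scales F γ hγ (hγ1.trans (sq_min_one_le _ 𝔠.gamma0_pos)) K).actionEta j ((h.pkgAtV2 hc γ hγ hγ1 K).UkH j hh W) := fun _ _ => rfl
  have hmeas : ∀ hh : Hist (F.P K) j, Measurable fun W : GaugeField (F.P K) j (Matrix.specialUnitaryGroup (Fin 2) ℂ) =>
      -((h.pkgAtV2 hc γ hγ hγ1 K).T.mainT j hh W) + (h.pkgAtV2 hc γ hγ hγ1 K).T.Pint j hh W + (h.pkgAtV2 hc γ hγ hγ1 K).T.Zterm j hh := by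
    intro hh
    simp_rw [hmain]
    exact ((measurable_const.mul ((Bound55Std.measurable_actionEta
      (S := T3Scales F γ hγ (hγ1.trans (sq_min_one_le _ 𝔠.gamma0_pos)) K) j).comp (hU hh))).neg.add (hPm hh)).add measurable_const
  have hbd : ∀ (hh : Hist (F.P K) j) (W : GaugeField (F.P K) j (Matrix.specialUnitaryGroup (Fin 2) ℂ)),
      -((h.pkgAtV2 hc γ hγ hγ1 K).T.mainT j hh W) + (h.pkgAtV2 hc γ hγ hγ1 K).T.Pint j hh W + (h.pkgAtV2 hc γ hγ hγ1 K).T.Zterm j hh ≤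
        cP + (h.pkgAtV2 hc γ hγ hγ1 K).T.Zterm j hh := by
    intro hh W
    have h0 : 0 ≤ (h.pkgAtV2 hc γ hγ hγ1 K).T.mainT j hh W := by
      rw [hmain]
      exact mul_nonneg (sq_nonneg _) (Bound55Std.actionEta_nonneg (S := T3Scales F γ hγ (hγ1.trans (sq_min_one_le _ 𝔠.gamma0_pos)) K) j _)
    have h1 : (h.pkgAtV2 hc γ hγ hγ1 K).T.Pint j hh W ≤ cP := hPb hh W
    linarith
  have hfun : (h.dataT3cW hc γ hγ hγ1 π).up K j = fun W =>
      h.wtW hc γ hγ hγ1 K j W * Real.exp (-((h.pkgAtV2 hc γ hγ hγ1 K).T.mainT j (Hist.triv (F.P K) j) W)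
          + (h.pkgAtV2 hc γ hγ hγ1 K).T.Pint j (Hist.triv (F.P K) j) W + (h.pkgAtV2 hc γ hγ hγ1 K).T.Zterm j (Hist.triv (F.P K) j)) +
        ∑ r ∈ Finset.univ.erase (Hist.triv (F.P K) j),
          (inputOfAC 𝔠.lane (h.pkgAtV2 hc γ hγ hγ1 K).X (h.pkgAtV2 hc γ hγ hγ1 K).𝔖).W.mass j r W *
            Real.exp (-((h.pkgAtV2 hc γ hγ hγ1 K).T.mainT j r W) + (h.pkgAtV2 hc γ hγ hγ1 K).T.Pint j r W
              + (h.pkgAtV2 hc γ hγ hγ1 K).T.Zterm j r) := funext fun W => h.dataT3cW_up_eq hc γ hγ hγ1 π K j W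
  rw [hfun]
  refine Integrable.add ?_ (integrable_finsetSum _ fun r _ => ?_)
  · exact integrable_mul_exp_of_le (h.integrable_wtW_and_integral_le hc γ hγ hγ1 K j).1 (hmeas _) (hbd _)
  · exact integrable_mul_exp_of_le (stdTowerInputAC_mass_integrable (h.pkgAtV2 hc γ hγ hγ1 K).X 𝔠.lane.carrier (h.pkgAtV2 hc γ hγ hγ1 K).𝔖 j r)
      (hmeas r) (hbd r)

/-- **THE WINDOWED MAJORANT IS INTEGRABLE, EVERY `j ≤ K`** (step rows below the top, terminal rows at the top — as `dataT3c_integrable_up`).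
[cite: Balaban1985UV3, (41) p.266] -/
theorem AlphaInputsT3AC.OfV2At.dataT3cW_integrable_up (K j : ℕ) (hj : j ≤ K) :
    Integrable ((h.dataT3cW hc γ hγ hγ1 π).up K j) (fieldMeasure (F.P K) j (Matrix.specialUnitaryGroup (Fin 2) ℂ)) := by
  rcases Nat.lt_or_eq_of_le hj with hlt | heq
  · have st := (h.pkgAtV2 hc γ hγ hγ1 K).run.steps j hlt
    exact h.integrable_upW_of_rows hc γ hγ hγ1 π K j st.hU st.hPm _ st.hPb
  · subst heq
    exact h.integrable_upW_of_rows hc γ hγ hγ1 π j j (h.pkgAtV2 hc γ hγ hγ1 j).terminal_measurable_UkH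
      (h.pkgAtV2 hc γ hγ hγ1 j).terminal_measurable_Pint _ (h.pkgAtV2 hc γ hγ hγ1 j).terminal_Pint_le

end Ineq

/-! ## §2 The bundle, in the quantifier order of line v5p3's STUB 2‴ (corrected: `1 ≤ j` in the support clause, `∫ ≤ max j 1`, no clause (iii)) -/

/-- **THE WINDOWED TRIVIAL WEIGHT OF THE v2 PACKAGE — WHAT STUB 2‴ OF LINE v5p3 CAN BE GIVEN TODAY** (seat alpha-1, for crux `HistoryTailL`):
for every block size `L`, record `𝔠` and [7]-constants there is a coupling threshold `γw = γwOf L b₀ p₀ > 0` such that for every family with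
`F.L = L`, every package `OfV2At F 𝔠 a₀ a₁`, every `γ ≤ γw` (inside the package's window) and all polymer fields `π`, the weight
`wt′ := OfV2At.wtW` satisfies: (a) `wt′ ≥ 0`; (b′) for `1 ≤ j ≤ K`, POINTWISE, `wt′ K j W ≠ 0 ⇒ Adm K j triv W` for the concrete datum `dataT3c`;
(c′) `wt′ K j` integrable with `∫ wt′ K j ≤ max j 1`; (d) `wt′ K j ≤` the lane's trivial weight `lfDataT3c.wt K j triv v` (so the windowed majorant is
below the lane's); (e) for every `j ≤ K`, `Ineq41AE` for the datum `dataT3c` with `LF` replaced by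
`Φ ↦ wt′ K j W·e^{Φ(triv)} + Σ_{r ≠ triv} lfDataT3c.wt K j r 1 W·e^{Φ(r)}` (the stub's structure update verbatim) and integrability of its majorant.
DIFFERENCES from the stub as registered (seat findings F-α1-9/10/11, module docstring): the support clause starts at `j = 1` ((41)₀ = (1) has no
characteristic function — the registered `j = 0` instance contradicts (41′)); the integral bound is `max j 1`, not `2` (floors of the lane's chain
compound; `K`-uniformity needs a kernel-form residual); the non-trivial support clause (iii) is not delivered (the lane's masses carry no window on
`Ω_{j}(r)`).  CONDITIONAL on the package; nothing of [Balaban1985UV3] asserted. [cite: Balaban1985UV3, (40)–(41) p.266, (47) p.267 and Thm 2 p.272] -/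
theorem AlphaInputsT3AC.windowedTrivialWeight_v2 :
    ∀ (L : ℕ) (𝔠 : AlphaConsts L (suGroupModel 2).N) (a₀ a₁ : ℝ),
      ∃ γw : ℝ, 0 < γw ∧
        ∀ (F : T3Family) (hF : F.L = L) (h : AlphaInputsT3AC.OfV2At F (hF ▸ 𝔠) a₀ a₁)
          (hc : 0 < a₀ ∧ 0 < a₁ ∧ (hF ▸ 𝔠).B₃ * a₁ ≤ a₀) (γ : ℝ) (hγ : 0 < γ) (hγ1 : γ ≤ (min (hF ▸ 𝔠).gamma0 1) ^ 2)
          (π : AlphaInputsT3AC.PolymerT3 F), γ ≤ γw →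
          (∀ (K j : ℕ) (Wf : GaugeField (F.P K) j (Matrix.specialUnitaryGroup (Fin 2) ℂ)), 0 ≤ h.wtW hc γ hγ hγ1 K j Wf) ∧
          (∀ (K j : ℕ), 1 ≤ j → j ≤ K → ∀ Wf : GaugeField (F.P K) j (Matrix.specialUnitaryGroup (Fin 2) ℂ),
            h.wtW hc γ hγ hγ1 K j Wf ≠ 0 →
              (h.dataT3c hc γ hγ hγ1 π).Adm K j (Summit.QuantumFields.Balaban3D.Carriers.Hist.triv (F.P K) j) Wf) ∧
          (∀ (K j : ℕ),
            Integrable (h.wtW hc γ hγ hγ1 K j) (fieldMeasure (F.P K) j (Matrix.specialUnitaryGroup (Fin 2) ℂ)) ∧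
            ∫ Wf, h.wtW hc γ hγ hγ1 K j Wf ∂fieldMeasure (F.P K) j (Matrix.specialUnitaryGroup (Fin 2) ℂ) ≤ max (j : ℝ) 1) ∧
          (∀ (K j : ℕ), j ≤ K → ∀ (v : (i : Fin j) → GaugeField (F.P K) i (Matrix.specialUnitaryGroup (Fin 2) ℂ))
            (Wf : GaugeField (F.P K) j (Matrix.specialUnitaryGroup (Fin 2) ℂ)),
            h.wtW hc γ hγ hγ1 K j Wf ≤ (h.lfDataT3c hc γ hγ hγ1 π).wt K j ((h.lfDataT3c hc γ hγ hγ1 π).trivReg K j) v Wf) ∧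
          (∀ (K j : ℕ), j ≤ K →
            Ineq41AE ({ h.dataT3c hc γ hγ hγ1 π with
                LF := fun K j Wf Φ => h.wtW hc γ hγ hγ1 K j Wf * Real.exp (Φ (Summit.QuantumFields.Balaban3D.Carriers.Hist.triv (F.P K) j)) +
                  ∑ r ∈ Finset.univ.erase (Summit.QuantumFields.Balaban3D.Carriers.Hist.triv (F.P K) j),
                    (h.lfDataT3c hc γ hγ hγ1 π).wt K j r (fun _ => 1) Wf * Real.exp (Φ r) } : AlphaDataT3 F γ) K j ∧
            Integrable (AlphaDataT3.up ({ h.dataT3c hc γ hγ hγ1 π with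
                LF := fun K j Wf Φ => h.wtW hc γ hγ hγ1 K j Wf * Real.exp (Φ (Summit.QuantumFields.Balaban3D.Carriers.Hist.triv (F.P K) j)) +
                  ∑ r ∈ Finset.univ.erase (Summit.QuantumFields.Balaban3D.Carriers.Hist.triv (F.P K) j),
                    (h.lfDataT3c hc γ hγ hγ1 π).wt K j r (fun _ => 1) Wf * Real.exp (Φ r) } : AlphaDataT3 F γ) K j)
              (fieldMeasure (F.P K) j (Matrix.specialUnitaryGroup (Fin 2) ℂ))) := by
  intro L 𝔠 a₀ a₁
  refine ⟨AlphaInputsT3AC.γwOf L 𝔠.b₀ 𝔠.p₀, AlphaInputsT3AC.γwOf_pos L 𝔠.b₀ 𝔠.p₀, ?_⟩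
  intro F hF
  subst hF
  intro h hc γ hγ hγ1 π hγw
  exact ⟨fun K j Wf => h.wtW_nonneg hc γ hγ hγ1 K j Wf,
    fun K j hj1 hj Wf hW => h.adm_triv_of_wtW_ne_zero hc γ hγ hγ1 π K j hj1 hj Wf hW,
    fun K j => h.integrable_wtW_and_integral_le hc γ hγ hγ1 K j,
    fun K j hj v Wf => h.wtW_le_wt_triv hc γ hγ hγ1 π K j hj v Wf,
    fun K j hj => ⟨h.dataT3cW_ineq41AE hc γ hγ hγ1 π hγw K j hj, h.dataT3cW_integrable_up hc γ hγ hγ1 π K j hj⟩⟩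



end Summit.QuantumFields.YangMills.Theorems

end
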